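import Summits.CriticalPhenomena.SAWScalingLimit.Theorems.SAWTotalPositivityCriticalBubbleBoundKestenDefs
import Literature.Probability.RandomPlanarGeometry.SelfAvoidingWalkProofs

/-!
# Line `kesten-product-renewal-dictionary` for the crux `SAWTotalPositivity.CriticalBubbleBound`
(stmt-CriticalPhenomena-7117): strip-gap programme, step T4 — a strip gap makes `L(v)` finite

The length-weighted pinned critical bridge mass `L(v) = Σ_{W : tip W = v} |W| x_c^{|W|}`
(`Kesten.pinnedLengthMass`, `Theorems/SAWTotalPositivityCriticalBubbleBoundKestenDefs.lean`) is finite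
for every site `v` of `ℤ²` as soon as the self-avoiding walks confined to a strip have an exponential
gap below `μ`: if for every width `w` the `n`-step walks `ω` from `0` with all first coordinates within
`w` of each other number at most `C ρⁿ` with `ρ < μ = Zd.connectiveConstant 2`, then `L(v) < ∞`.

Proof (this file, `pinnedLengthMass_lt_top_of_gap`): a bridge `W` with tip `v` has all its first
coordinates in `[0, v 0]` (`column_nonneg_le_of_mem_bridges`), so its vertex function lies in the
`(v 0).toNat`-narrow set and the `n`-step bridges pinned at `v` number at most `C ρⁿ`
(`card_filter_tip_le`); slicing the sum over `Bridge = Σ n, Zd.bridges 2 n` by length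
(`ENNReal.tsum_sigma'`, `tsum_fintype`) gives `L(v) ≤ Σ_n C n (ρ x_c)ⁿ = ENNReal.ofReal (Σ_n C n (ρ x_c)ⁿ)`,
finite because `ρ x_c < μ x_c = 1` (`hasSum_coe_mul_geometric_of_norm_lt_one`).

This is the floor under the line's open stub B1 (`Kesten.PinnedLengthMassBound`); the strip gap itself
is proved elsewhere in the line (stubs T1–T3) and is taken here as the HYPOTHESIS of the theorem.

Source of the objects: N. Madras, G. Slade, *The Self-Avoiding Walk* (1993), Definition 1.2.4 (bridges),
§4.2 (Kesten's renewal structure); the estimate itself is elementary. [folklore]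
-/

noncomputable section

open Literature.Probability.LatticeModels
open Literature.Probability.RandomPlanarGeometry Literature.Probability.RandomPlanarGeometry.SAW
open scoped ENNReal NNReal BigOperators

namespace Summit.CriticalPhenomena.SAWScalingLimit.Theorems.CriticalBubbleBound.Kesten.Strip

/-! ## Bridges pinned at `v` are `(v 0)`-narrow -/

/-- The first coordinates of an `n`-step bridge from the origin lie in `[0, ω n 0]` on `[0, n]`
(`ω 0 = 0` and `0 = ω 0 0 < ω i 0 ≤ ω n 0` for `1 ≤ i ≤ n`). [cite: MadrasSlade1993, Definition 1.2.4] -/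
theorem column_nonneg_le_of_mem_bridges {n : ℕ} {ω : ℕ → Site 2} (hω : ω ∈ Zd.bridges 2 n)
    {i : ℕ} (hi : i ≤ n) : 0 ≤ ω i 0 ∧ ω i 0 ≤ ω n 0 := by
  obtain ⟨hs, hb⟩ := Zd.mem_bridges.1 hω
  have h0 : ω 0 0 = 0 := by rw [(Zd.mem_saws.1 hs).1]; rfl
  have hlow : ∀ j ≤ n, 0 ≤ ω j 0 := by
    intro j hj
    rcases Nat.eq_zero_or_pos j with rfl | hjpos
    · rw [h0]
    · rw [← h0]
      exact (hb j hjpos hj).1.le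
  refine ⟨hlow i hi, ?_⟩
  rcases Nat.eq_zero_or_pos i with rfl | hipos
  · rw [h0]
    exact hlow n le_rfl
  · exact (hb i hipos hi).2

/-- **Key inclusion.** The `n`-step bridges with tip `v` inject (by their vertex function) into the
`(v 0).toNat`-narrow `n`-step self-avoiding walks: all their first coordinates lie in `[0, v 0]`, so any
two of them differ by at most `(v 0).toNat`. [folklore] -/
theorem card_filter_tip_le (v : Site 2) (n : ℕ) :
    (Finset.univ.filter (fun b : ↥(Zd.bridges 2 n) => Bridge.tip ⟨n, b⟩ = v)).card ≤
      ((Zd.saws 2 n).filter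
        (fun ω => ∀ i ≤ n, ∀ i' ≤ n, ω i 0 ≤ ω i' 0 + (((v 0).toNat : ℕ) : ℤ))).card := by
  refine Finset.card_le_card_of_injOn (fun b => b.1) (fun b hb => ?_) Subtype.val_injective.injOn
  have hbv : b.1 n = v := (Finset.mem_filter.1 hb).2
  obtain ⟨hs, -⟩ := Zd.mem_bridges.1 b.2
  refine Finset.mem_coe.2 (Finset.mem_filter.2 ⟨hs, fun i hi i' hi' => ?_⟩)
  have h1 := (column_nonneg_le_of_mem_bridges b.2 hi).2
  have h2 := (column_nonneg_le_of_mem_bridges b.2 hi').1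
  have h3 : b.1 n 0 ≤ (((v 0).toNat : ℕ) : ℤ) := by
    rw [hbv]
    exact Int.self_le_toNat (v 0)
  linarith

/-- **Length slice.** For each `n`, the length-`n` slice of `L(v)` — the finite sum over the `n`-step
bridges `b` of `n x_cⁿ · [tip b = v]` — is at most `ENNReal.ofReal B · n x_cⁿ` whenever the
`(v 0).toNat`-narrow `n`-step walks number at most `B`. [folklore] -/
theorem sum_slice_le (v : Site 2) (n : ℕ) {B : ℝ}
    (hB : (((Zd.saws 2 n).filter
      (fun ω => ∀ i ≤ n, ∀ i' ≤ n, ω i 0 ≤ ω i' 0 + (((v 0).toNat : ℕ) : ℤ))).card : ℝ) ≤ B) :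
    ∑ b : ↥(Zd.bridges 2 n),
        (if Bridge.tip ⟨n, b⟩ = v then (n : ℝ≥0∞) * ENNReal.ofReal (criticalFugacity ^ n) else 0) ≤
      ENNReal.ofReal B * ((n : ℝ≥0∞) * ENNReal.ofReal (criticalFugacity ^ n)) := by
  rw [← Finset.sum_filter, Finset.sum_const, nsmul_eq_mul]
  gcongr
  calc ((Finset.univ.filter (fun b : ↥(Zd.bridges 2 n) => Bridge.tip ⟨n, b⟩ = v)).card : ℝ≥0∞)
      ≤ (((Zd.saws 2 n).filter
          (fun ω => ∀ i ≤ n, ∀ i' ≤ n, ω i 0 ≤ ω i' 0 + (((v 0).toNat : ℕ) : ℤ))).card : ℝ≥0∞) := by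
        exact_mod_cast card_filter_tip_le v n
    _ ≤ ENNReal.ofReal B := by
        rw [← ENNReal.ofReal_natCast]
        exact ENNReal.ofReal_le_ofReal hB

/-! ## The strip gap makes `L(v)` finite -/

/-- **Strip gap ⇒ `L(v) < ∞`** (strip-gap programme, step T4; the floor under the line's stub B1).
If for every width `w` the `n`-step self-avoiding walks from `0` whose first coordinates stay within `w`
of each other number at most `C ρⁿ` for some `ρ < μ(ℤ²)`, then the length-weighted critical mass of the
bridges pinned at any site `v` is finite: a bridge with tip `v` is `(v 0)`-narrow, so
`L(v) ≤ Σ_n C n (ρ x_c)ⁿ < ∞` as `ρ x_c < μ x_c = 1`. [folklore] -/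
theorem pinnedLengthMass_lt_top_of_gap : (∀ w : ℕ, ∃ ρ : ℝ, 0 ≤ ρ ∧ ρ < Zd.connectiveConstant 2 ∧ ∃ C : ℝ, ∀ n : ℕ, (((Zd.saws 2 n).filter (fun ω => ∀ i ≤ n, ∀ i' ≤ n, ω i 0 ≤ ω i' 0 + (w : ℤ))).card : ℝ) ≤ C * ρ ^ n) → ∀ v : Site 2, pinnedLengthMass v < ⊤ := by
  intro hgap v
  obtain ⟨ρ, hρ0, hρμ, C, hC⟩ := hgap (v 0).toNat
  -- constants: `0 < x_c`, `0 ≤ ρ x_c < 1`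
  have hx : 0 < criticalFugacity := criticalFugacity_pos_lt_one'.1
  have hρμ' : ρ < connectiveConstant := by
    rw [Zd.connectiveConstant_two] at hρμ
    exact hρμ
  have hμpos : 0 < connectiveConstant := hρ0.trans_lt hρμ'
  have hxc : criticalFugacity = connectiveConstant⁻¹ := rfl
  have hr0 : 0 ≤ ρ * criticalFugacity := mul_nonneg hρ0 hx.le
  have hr1 : ρ * criticalFugacity < 1 := by
    rw [hxc]
    calc ρ * connectiveConstant⁻¹ < connectiveConstant * connectiveConstant⁻¹ :=
          mul_lt_mul_of_pos_right hρμ' (inv_pos.2 hμpos)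
      _ = 1 := mul_inv_cancel₀ hμpos.ne'
  have hnorm : ‖ρ * criticalFugacity‖ < 1 := by
    rw [Real.norm_of_nonneg hr0]
    exact hr1
  -- WLOG `0 ≤ C`
  have hC'0 : (0 : ℝ) ≤ max C 0 := le_max_right _ _
  have hC'n := fun n : ℕ =>
    (hC n).trans (mul_le_mul_of_nonneg_right (le_max_left C 0) (pow_nonneg hρ0 n))
  -- the real majorant `n ↦ C' n (ρ x_c)ⁿ` is summable
  have hg0 : ∀ n : ℕ, 0 ≤ max C 0 * ((n : ℝ) * (ρ * criticalFugacity) ^ n) := fun n =>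
    mul_nonneg hC'0 (mul_nonneg n.cast_nonneg (pow_nonneg hr0 n))
  have hgs : Summable (fun n : ℕ => max C 0 * ((n : ℝ) * (ρ * criticalFugacity) ^ n)) :=
    (hasSum_coe_mul_geometric_of_norm_lt_one hnorm).summable.mul_left (max C 0)
  -- main estimate, slice by length
  have key : pinnedLengthMass v ≤
      ∑' n : ℕ, ENNReal.ofReal (max C 0 * ((n : ℝ) * (ρ * criticalFugacity) ^ n)) := by
    unfold pinnedLengthMass
    rw [ENNReal.tsum_sigma']
    refine ENNReal.tsum_le_tsum fun n => ?_
    rw [tsum_fintype]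
    show ∑ b : ↥(Zd.bridges 2 n),
        (if Bridge.tip ⟨n, b⟩ = v then (n : ℝ≥0∞) * ENNReal.ofReal (criticalFugacity ^ n) else 0) ≤ _
    refine (sum_slice_le v n (hC'n n)).trans (le_of_eq ?_)
    rw [← ENNReal.ofReal_natCast n, ← ENNReal.ofReal_mul n.cast_nonneg,
      ← ENNReal.ofReal_mul (mul_nonneg hC'0 (pow_nonneg hρ0 n)), mul_pow]
    congr 1
    ring
  have hfin : ∑' n : ℕ, ENNReal.ofReal (max C 0 * ((n : ℝ) * (ρ * criticalFugacity) ^ n)) < ⊤ := by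
    rw [← ENNReal.ofReal_tsum_of_nonneg hg0 hgs]
    exact ENNReal.ofReal_lt_top
  exact lt_of_le_of_lt key hfin

end Summit.CriticalPhenomena.SAWScalingLimit.Theorems.CriticalBubbleBound.Kesten.Strip

end
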